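import Summits.CriticalPhenomena.CardyFormulaZ2.Theorems.HalfPlaneMarkDensityLaw.Negative.MarkEvents
import Summits.CriticalPhenomena.CardyFormulaZ2.Theorems.CardyBoundaryCoulombGasHalfPlaneMarkDensityLawSymmDiffInclusion
import Summits.CriticalPhenomena.CardyFormulaZ2.Theorems.CardyComplexConeCoherentMoreraKirchhoffFlip
import Literature.Probability.Percolation.PlanarDuality
import Literature.Probability.Percolation.RSW

/-!
# `HalfPlaneMarkDensityLaw` (crux stmt-CriticalPhenomena-5661), line `Sketch`:
# stub `stub_firstHitSuccLe` — the unit-scale one-sided ratio bound `P[E(k+1)] ≤ 4 · P[E(k)]`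

For critical bond percolation on `ℤ²`, a boundary arc `A = [α,β] × {0}` of the lattice half-plane
`H = ℤ × ℕ` and a window start `k₀ > β`, the first-hit events
`E(j) = firstHit H A k₀ j = {A ↔ (j,0) in H} \ {A ↔ [k₀,j) × {0} in H}` satisfy, for every `k ≥ k₀`,
`P[E(k+1)] ≤ 4 · P[E(k)]`: the lattice mark density never jumps up by more than a factor `4`
from one boundary site to the next.

* THREE-EDGE SURGERY (deterministic, `firstHit_of_surgery`). On a lattice configuration
  `ω ∈ E(k+1)` the right edge `e₁ = {(k,0),(k+1,0)}` is closed (`right_notMem`). Let `ω'` agree with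
  `ω` off the edges at `(k,0)`, with `e₁` open and the left edge `{(k,0),(k−1,0)}` and the up edge
  `{(k,0),(k,1)}` closed. An open path of `ω` in `H` from `A` to `(k+1,0)` avoids the VERTEX `(k,0)`
  (else `(k,0) ∈ [k₀,k+1) × {0}` would be joined to `A`), so it is open in `ω'`, and the edge `e₁`
  extends it to `(k,0)`. Conversely an `ω'`-open path in `H` from `A` to `v ∈ [k₀,k) × {0}` cannot
  pass through `(k,0)`, a vertex of `ω'`-degree one inside `H` (a path entering and leaving it would
  use the edge `e₁` twice), and cannot end or start there; so it avoids `(k,0)`, is open in `ω`, and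
  would join `A` to `[k₀,k+1) × {0}` in `ω`. Hence `ω' ∈ E(k)`.
* FLIP INVARIANCE (`map_symmDiff_finset_half`). `ω' = ω ∆ ({e₁} ∪ D)` where `D ⊆ {left, up}` is the
  set of those two edges open in `ω`; for each of the `4` candidates `D` the map
  `ω ↦ ω ∆ ({e₁} ∪ D)` preserves `P_{1/2}` (composition of single-edge flips, tree
  `bondPercolation_half_map_toggle`), so `P[E(k+1)] ≤ Σ_D P[ω ∆ ({e₁} ∪ D) ∈ E(k)] = 4 · P[E(k)]`
  (`measureReal_le_card_mul`).
-/

noncomputable section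

namespace Summit.CriticalPhenomena.CardyFormulaZ2.Cruxes.HalfPlaneMarkDensityLaw.SketchLine

open Literature.Probability.Percolation Literature.Probability.LatticeModels
open MeasureTheory Filter Set SimpleGraph
open scoped Topology
open Summit.CriticalPhenomena.CardyFormulaZ2.Theorems.HalfPlaneMarkDensityLaw.Negative

namespace TwoArmLower

namespace FirstHitSucc

open scoped symmDiff
open Summit.CriticalPhenomena.CardyFormulaZ2.Cruxes.CoherentMorera.FinitaryGreenPairing
  (bondPercolation_half_map_toggle measurable_toggle)
open SymmDiff (bpt_apply_zero bpt_apply_one)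

/-! ### Flipping finitely many edges preserves `P_{1/2}` -/

section Flip

variable {V : Type*}

/-- `ω ↦ ω ∆ D` is measurable, for any fixed set of pairs `D`. [folklore] -/
theorem measurable_symmDiff_const (D : Set (Sym2 V)) :
    Measurable fun ω : BondConfig V => ω ∆ D := by
  refine measurable_set_iff.2 fun i => ?_
  by_cases hi : i ∈ D
  · have : (fun ω : BondConfig V => i ∈ ω ∆ D) = fun ω => i ∉ ω := by
      funext ω; apply propext; simp [Set.mem_symmDiff, hi]
    rw [this]; exact measurable_set_notMem i
  · have : (fun ω : BondConfig V => i ∈ ω ∆ D) = fun ω => i ∈ ω := by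
      funext ω; apply propext; simp [Set.mem_symmDiff, hi]
    rw [this]; exact measurable_set_mem i

/-- Flipping the pairs of `insert a D` (`a ∉ D`) is flipping those of `D`, then `a`. [folklore] -/
theorem symmDiff_insert_eq {a : Sym2 V} {D : Set (Sym2 V)} (ha : a ∉ D) (ω : BondConfig V) :
    ω ∆ insert a D = (ω ∆ D) ∆ {a} := by
  rw [symmDiff_assoc]
  congr 1
  ext e
  simp only [Set.mem_insert_iff, Set.mem_symmDiff, Set.mem_singleton_iff]
  by_cases he : e = a
  · subst he; simp [ha]
  · simp [he]

/-- **Flipping finitely many edges of `G` preserves `P_{1/2}`** (composition of the single-edge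
flips `bondPercolation_half_map_toggle`). [folklore] -/
theorem map_symmDiff_finset_half [Countable V] (G : SimpleGraph V) (D : Finset (Sym2 V))
    (hD : ∀ e ∈ D, e ∈ G.edgeSet) :
    (bondPercolation G half).map (fun ω : BondConfig V => ω ∆ (↑D : Set (Sym2 V))) =
      bondPercolation G half := by
  classical
  induction D using Finset.induction_on with
  | empty =>
    have : (fun ω : BondConfig V => ω ∆ (↑(∅ : Finset (Sym2 V)) : Set (Sym2 V))) = id := by
      funext ω; rw [Finset.coe_empty, ← Set.bot_eq_empty]; exact symmDiff_bot ω
    rw [this, Measure.map_id]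
  | insert a D ha ih =>
    have hcomp : (fun ω : BondConfig V => ω ∆ (↑(insert a D) : Set (Sym2 V))) =
        (fun ω : BondConfig V => ω ∆ {a}) ∘ fun ω => ω ∆ (↑D : Set (Sym2 V)) := by
      funext ω
      rw [Function.comp_apply, Finset.coe_insert, symmDiff_insert_eq (by exact_mod_cast ha)]
    rw [hcomp, ← Measure.map_map (measurable_toggle a) (measurable_symmDiff_const _),
      ih fun e he => hD e (Finset.mem_insert_of_mem he),
      bondPercolation_half_map_toggle G (hD a (Finset.mem_insert_self a D))]

/-- Hence the preimage of an event under a finite flip has the same probability. [folklore] -/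
theorem real_preimage_symmDiff_half [Countable V] (G : SimpleGraph V) (D : Finset (Sym2 V))
    (hD : ∀ e ∈ D, e ∈ G.edgeSet) {B : Set (BondConfig V)} (hB : MeasurableSet B) :
    (bondPercolation G half).real ((fun ω : BondConfig V => ω ∆ (↑D : Set (Sym2 V))) ⁻¹' B) =
      (bondPercolation G half).real B := by
  rw [measureReal_def, measureReal_def, ← Measure.map_apply (measurable_symmDiff_const _) hB,
    map_symmDiff_finset_half G D hD]

/-- A non-trivial walk leaves its start through an edge. [folklore] -/
theorem exists_adj_of_ne {G : SimpleGraph V} {a b : V} (w : G.Walk a b) (hab : a ≠ b) :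
    ∃ c, G.Adj a c ∧ s(a, c) ∈ w.edges ∧ c ∈ w.support := by
  cases w with
  | nil => exact absurd rfl hab
  | cons h t => exact ⟨_, h, by simp, by simp⟩

end Flip

/-! ### Union bound over finitely many measure-preserving maps -/

/-- If every lattice configuration of `E'` is sent into `E` by one of finitely many maps `f i`,
`i ∈ P`, each of which pulls `E` back to an event of the same probability, then
`P[E'] ≤ #P · P[E]`. [folklore] -/
theorem measureReal_le_card_mul {ι : Type*} (P : Finset ι)
    (f : ι → BondConfig (Site 2) → BondConfig (Site 2)) {E E' : Set (BondConfig (Site 2))}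
    (hf : ∀ i ∈ P, μ.real (f i ⁻¹' E) = μ.real E)
    (hincl : ∀ ω, ω ⊆ (zdGraph 2).edgeSet → ω ∈ E' → ∃ i ∈ P, f i ω ∈ E) :
    μ.real E' ≤ P.card * μ.real E := by
  have hae : E' ≤ᵐ[μ] ⋃ i ∈ P, f i ⁻¹' E :=
    (ae_subset_edgeSet (zdGraph 2) half).mono fun ω hω h => by
      obtain ⟨i, hi, hmem⟩ := hincl ω hω h
      exact Set.mem_iUnion₂.2 ⟨i, hi, hmem⟩
  calc μ.real E' ≤ μ.real (⋃ i ∈ P, f i ⁻¹' E) :=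
        ENNReal.toReal_mono (measure_ne_top _ _) (measure_mono_ae hae)
    _ ≤ ∑ i ∈ P, μ.real (f i ⁻¹' E) := measureReal_biUnion_finset_le _ _
    _ = ∑ i ∈ P, μ.real E := Finset.sum_congr rfl hf
    _ = P.card * μ.real E := by rw [Finset.sum_const, nsmul_eq_mul]

/-! ### Geometry at the boundary vertex `(k,0)` (coordinates: tree `SymmDiff.bpt_apply_zero`) -/

/-- `k ↦ (k,0)` is injective. [folklore] -/
lemma bpt_inj {a b : ℤ} (h : bpt a = bpt b) : a = b := by
  simpa only [bpt_apply_zero] using congrFun h 0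

/-- `(k,1)` is not a boundary vertex. [folklore] -/
lemma up_ne_bpt (k j : ℤ) : (![k, 1] : Site 2) ≠ bpt j := fun h => by
  simpa using congrFun h 1

/-- The right edge at `(k,0)` is a lattice edge. [folklore] -/
lemma adj_bpt_succ (k : ℤ) : (zdGraph 2).Adj (bpt k) (bpt (k + 1)) :=
  (zdGraph_two_adj_iff _ _).2
    (Or.inl ⟨by simp only [bpt_apply_zero], by simp only [bpt_apply_one]⟩)

/-- The left edge at `(k,0)` is a lattice edge. [folklore] -/
lemma adj_bpt_pred (k : ℤ) : (zdGraph 2).Adj (bpt k) (bpt (k - 1)) :=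
  (zdGraph_two_adj_iff _ _).2
    (Or.inr (Or.inl ⟨by simp only [bpt_apply_zero]; omega, by simp only [bpt_apply_one]⟩))

/-- The up edge at `(k,0)` is a lattice edge. [folklore] -/
lemma adj_bpt_up (k : ℤ) : (zdGraph 2).Adj (bpt k) ![k, 1] :=
  (zdGraph_two_adj_iff _ _).2 (Or.inr (Or.inr (Or.inl ⟨by simp, by simp⟩)))

/-- **Degree one.** If the left and up edges at `(k,0)` are closed in `ω'`, the only `ω'`-open
lattice edge at `(k,0)` with other endpoint in the half-plane is the right edge. [folklore] -/
lemma eq_bpt_succ {ω' : BondConfig (Site 2)} {k : ℤ} (h₂ : s(bpt k, bpt (k - 1)) ∉ ω')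
    (h₃ : s(bpt k, ![k, 1]) ∉ ω') {c : Site 2} (hadj : (zdGraph 2).Adj (bpt k) c)
    (hc : c ∈ halfPlane) (hopen : s(bpt k, c) ∈ ω') : c = bpt (k + 1) := by
  have hc' : 0 ≤ c 1 := hc
  rcases (zdGraph_two_adj_iff (bpt k) c).1 hadj with ⟨h0, h1⟩ | ⟨h0, h1⟩ | ⟨h1, h0⟩ | ⟨h1, h0⟩ <;>
    simp only [bpt_apply_zero, bpt_apply_one, zero_add] at h0 h1
  · exact (site_eq_bpt_iff c (k + 1)).2 ⟨h1, h0⟩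
  · obtain rfl : c = bpt (k - 1) := (site_eq_bpt_iff c (k - 1)).2 ⟨h1, by omega⟩
    exact absurd hopen h₂
  · obtain rfl : c = ![k, 1] := by
      funext i; fin_cases i
      · simpa using h0
      · simpa using h1
    exact absurd hopen h₃
  · omega

/-! ### The three-edge surgery -/

/-- (i) On `E(k+1)` the right edge at `(k,0)` is closed: otherwise `(k,0) ∈ [k₀,k+1) × {0}` would be
joined to the arc through `(k+1,0)`. [folklore] -/
theorem right_notMem {α β k₀ k : ℤ} (hk : k₀ ≤ k) {ω : BondConfig (Site 2)}
    (hE : ω ∈ firstHit halfPlane (rowIcc α β) k₀ (k + 1)) : s(bpt k, bpt (k + 1)) ∉ ω := by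
  intro he
  obtain ⟨⟨x, hx, y, hy, hxy⟩, hnot⟩ := hE
  obtain rfl : y = bpt (k + 1) := hy
  refine hnot ⟨x, hx, bpt k, ⟨rfl, hk, show k < k + 1 by omega⟩, PlanarDuality.openConnIn_trans hxy
    (openConnIn_of_adj (by simp [halfPlane]) (by simp [halfPlane]) (by rwa [Sym2.eq_swap]) ?_)⟩
  exact fun h => by have := bpt_inj h; omega

/-- (ii)+(iii) **Three-edge surgery.** Let `ω ∈ E(k+1)` be a lattice configuration and let the
lattice configuration `ω'` agree with `ω` off the edges at `(k,0)`, with the right edge open and the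
left and up edges closed. Then `ω' ∈ E(k)`. [folklore] -/
theorem firstHit_of_surgery {α β k₀ k : ℤ} (hβ : β < k₀) (hk : k₀ ≤ k)
    {ω ω' : BondConfig (Site 2)} (hω : ω ⊆ (zdGraph 2).edgeSet) (hω' : ω' ⊆ (zdGraph 2).edgeSet)
    (hagree : ∀ e, bpt k ∉ e → (e ∈ ω' ↔ e ∈ ω)) (h₁ : s(bpt k, bpt (k + 1)) ∈ ω')
    (h₂ : s(bpt k, bpt (k - 1)) ∉ ω') (h₃ : s(bpt k, ![k, 1]) ∉ ω')
    (hE : ω ∈ firstHit halfPlane (rowIcc α β) k₀ (k + 1)) :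
    ω' ∈ firstHit halfPlane (rowIcc α β) k₀ k := by
  obtain ⟨⟨x, hx, y, hy, hxy⟩, hnot⟩ := hE
  obtain rfl : y = bpt (k + 1) := hy
  refine ⟨?_, ?_⟩
  · -- (ii) re-route the open path `A → (k+1,0)` of `ω` into `(k,0)` through the opened right edge
    obtain ⟨p, hpS, hpω⟩ := exists_walk_of_mem_openConnIn hω hxy
    have hkp : bpt k ∉ p.support := fun hmem =>
      hnot ⟨x, hx, bpt k, ⟨rfl, hk, show k < k + 1 by omega⟩,
        mem_openConnIn_of_mem_support p hpS hpω hmem⟩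
    refine ⟨x, hx, bpt k, rfl, mem_openConnIn_of_walk (p.concat (adj_bpt_succ k).symm) ?_ ?_⟩
    · intro z hz
      rw [Walk.support_concat, List.mem_append, List.mem_singleton] at hz
      rcases hz with hz | rfl
      · exact hpS z hz
      · simp [halfPlane]
    · intro e he
      rw [Walk.edges_concat, List.concat_eq_append, List.mem_append, List.mem_singleton] at he
      rcases he with he | rfl
      · exact (hagree e fun hke => hkp (Walk.mem_support_of_mem_edges he hke)).2 (hpω e he)
      · rw [Sym2.eq_swap]; exact h₁
  · -- (iii) no vertex of `[k₀,k) × {0}` is joined to the arc in `ω'`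
    rintro ⟨x', hx', v, hv, hx'v⟩
    obtain ⟨hx'1, hx'0, hx'0'⟩ := hx'
    obtain ⟨hv1, hv0, hv0'⟩ := hv
    obtain ⟨q, hqS, hqω, hq⟩ : ∃ q : (zdGraph 2).Walk x' v, (∀ z ∈ q.support, z ∈ halfPlane) ∧
        (∀ e ∈ q.edges, e ∈ ω') ∧ q.IsPath := by
      obtain ⟨q₀, hS, hω₀⟩ := exists_walk_of_mem_openConnIn hω' hx'v
      exact ⟨q₀.bypass, fun z hz => hS z (q₀.support_bypass_subset_support hz),
        fun e he => hω₀ e (q₀.edges_bypass_subset_edges he), q₀.bypass_isPath⟩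
    by_cases hmem : bpt k ∈ q.support
    · -- an interior visit of `(k,0)` enters and leaves through the only open edge there
      have hx'ne : bpt k ≠ x' := by
        rintro rfl
        rw [bpt_apply_zero] at hx'0'; omega
      have hvne : bpt k ≠ v := by
        rintro rfl
        rw [bpt_apply_zero] at hv0'; omega
      obtain ⟨c₁, hc₁a, hc₁e, hc₁s⟩ := exists_adj_of_ne (q.takeUntil (bpt k) hmem).reverse hx'ne
      obtain ⟨c₂, hc₂a, hc₂e, hc₂s⟩ := exists_adj_of_ne (q.dropUntil (bpt k) hmem) hvne
      rw [Walk.edges_reverse, List.mem_reverse] at hc₁e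
      rw [Walk.support_reverse, List.mem_reverse] at hc₁s
      have hc₁ := eq_bpt_succ h₂ h₃ hc₁a
        (hqS c₁ (q.support_takeUntil_subset_support hmem hc₁s))
        (hqω _ (q.edges_takeUntil_subset_edges hmem hc₁e))
      have hc₂ := eq_bpt_succ h₂ h₃ hc₂a
        (hqS c₂ (q.support_dropUntil_subset_support hmem hc₂s))
        (hqω _ (q.edges_dropUntil_subset_edges hmem hc₂e))
      subst hc₁ hc₂
      have hnd : ((q.takeUntil (bpt k) hmem).append (q.dropUntil (bpt k) hmem)).edges.Nodup := by
        rw [Walk.take_spec]; exact hq.isTrail.edges_nodup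
      rw [Walk.edges_append] at hnd
      exact List.disjoint_of_nodup_append hnd hc₁e hc₂e
    · exact hnot ⟨x', ⟨hx'1, hx'0, hx'0'⟩, v, ⟨hv1, hv0, by omega⟩,
        mem_openConnIn_of_walk q hqS fun e he =>
          (hagree e fun hke => hmem (Walk.mem_support_of_mem_edges he hke)).1 (hqω e he)⟩

/-- The surgery as a flip: for `ω ∈ E(k+1)` and `D` the set of left/up edges at `(k,0)` open in
`ω`, the configuration `ω ∆ ({right edge} ∪ D)` lies in `E(k)`. [folklore] -/
theorem symmDiff_mem_firstHit {α β k₀ k : ℤ} (hβ : β < k₀) (hk : k₀ ≤ k) {ω : BondConfig (Site 2)}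
    (hω : ω ⊆ (zdGraph 2).edgeSet) (hE : ω ∈ firstHit halfPlane (rowIcc α β) k₀ (k + 1))
    {D : Set (Sym2 (Site 2))} (hDω : D ⊆ ω) (hDk : ∀ e ∈ D, bpt k ∈ e)
    (hD₂ : s(bpt k, bpt (k - 1)) ∈ ω → s(bpt k, bpt (k - 1)) ∈ D)
    (hD₃ : s(bpt k, ![k, 1]) ∈ ω → s(bpt k, ![k, 1]) ∈ D) :
    ω ∆ insert s(bpt k, bpt (k + 1)) D ∈ firstHit halfPlane (rowIcc α β) k₀ k := by
  have h₁ω : s(bpt k, bpt (k + 1)) ∉ ω := right_notMem hk hE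
  refine firstHit_of_surgery hβ hk hω ?_ ?_ ?_ ?_ ?_ hE
  · intro e he
    rcases Set.mem_symmDiff.1 he with ⟨heω, -⟩ | ⟨heI, -⟩
    · exact hω heω
    · rcases Set.mem_insert_iff.1 heI with rfl | heD
      · exact (SimpleGraph.mem_edgeSet _).2 (adj_bpt_succ k)
      · exact hω (hDω heD)
  · intro e hke
    have heI : e ∉ insert s(bpt k, bpt (k + 1)) D := by
      rintro (rfl | heD)
      · exact hke (Sym2.mem_mk_left _ _)
      · exact hke (hDk e heD)
    simp [Set.mem_symmDiff, heI]
  · exact Set.mem_symmDiff.2 (Or.inr ⟨Set.mem_insert _ _, h₁ω⟩)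
  · intro h
    rcases Set.mem_symmDiff.1 h with ⟨heω, hnI⟩ | ⟨heI, hnω⟩
    · exact hnI (Set.mem_insert_of_mem _ (hD₂ heω))
    · rcases Set.mem_insert_iff.1 heI with he | heD
      · have := bpt_inj (Sym2.congr_right.1 he); omega
      · exact hnω (hDω heD)
  · intro h
    rcases Set.mem_symmDiff.1 h with ⟨heω, hnI⟩ | ⟨heI, hnω⟩
    · exact hnI (Set.mem_insert_of_mem _ (hD₃ heω))
    · rcases Set.mem_insert_iff.1 heI with he | heD
      · exact up_ne_bpt k (k + 1) (Sym2.congr_right.1 he)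
      · exact hnω (hDω heD)

/-- MEASURE STEP, piece 1: each of the four flips pulls `E(k)` back to an event of the same
probability. [folklore] -/
theorem real_preimage_flip {k : ℤ} {D : Finset (Sym2 (Site 2))}
    (hD : D ∈ ({s(bpt k, bpt (k - 1)), s(bpt k, ![k, 1])} : Finset (Sym2 (Site 2))).powerset)
    {B : Set (BondConfig (Site 2))} (hB : MeasurableSet B) :
    μ.real ((fun ω : BondConfig (Site 2) =>
        ω ∆ (↑(insert s(bpt k, bpt (k + 1)) D) : Set (Sym2 (Site 2)))) ⁻¹' B) = μ.real B := by
  refine real_preimage_symmDiff_half (zdGraph 2) _ (fun e he => ?_) hB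
  rcases Finset.mem_insert.1 he with rfl | he
  · exact (SimpleGraph.mem_edgeSet _).2 (adj_bpt_succ k)
  · rcases Finset.mem_insert.1 (Finset.mem_powerset.1 hD he) with rfl | he
    · exact (SimpleGraph.mem_edgeSet _).2 (adj_bpt_pred k)
    · rw [Finset.mem_singleton.1 he]; exact (SimpleGraph.mem_edgeSet _).2 (adj_bpt_up k)

/-- MEASURE STEP, piece 2: every lattice configuration of `E(k+1)` is sent into `E(k)` by the flip
indexed by its own left/up pattern. [folklore] -/
theorem exists_flip_mem {α β k₀ k : ℤ} (hβ : β < k₀) (hk : k₀ ≤ k) (ω : BondConfig (Site 2))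
    (hω : ω ⊆ (zdGraph 2).edgeSet) (hE : ω ∈ firstHit halfPlane (rowIcc α β) k₀ (k + 1)) :
    ∃ D ∈ ({s(bpt k, bpt (k - 1)), s(bpt k, ![k, 1])} : Finset (Sym2 (Site 2))).powerset,
      ω ∆ (↑(insert s(bpt k, bpt (k + 1)) D) : Set (Sym2 (Site 2))) ∈
        firstHit halfPlane (rowIcc α β) k₀ k := by
  classical
  refine ⟨({s(bpt k, bpt (k - 1)), s(bpt k, ![k, 1])} : Finset (Sym2 (Site 2))).filter (· ∈ ω),
    Finset.mem_powerset.2 (Finset.filter_subset _ _), ?_⟩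
  rw [Finset.coe_insert]
  refine symmDiff_mem_firstHit hβ hk hω hE ?_ ?_ ?_ ?_
  · intro e he
    exact (Finset.mem_filter.1 (Finset.mem_coe.1 he)).2
  · intro e he
    rcases Finset.mem_insert.1 (Finset.mem_filter.1 (Finset.mem_coe.1 he)).1 with rfl | h
    · exact Sym2.mem_mk_left _ _
    · rw [Finset.mem_singleton.1 h]; exact Sym2.mem_mk_left _ _
  · intro h
    exact Finset.mem_coe.2 (Finset.mem_filter.2 ⟨Finset.mem_insert_self _ _, h⟩)
  · intro h
    exact Finset.mem_coe.2
      (Finset.mem_filter.2 ⟨Finset.mem_insert_of_mem (Finset.mem_singleton_self _), h⟩)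

/-- There are at most four left/up patterns. [folklore] -/
lemma card_powerset_pair_le (a b : Sym2 (Site 2)) :
    ((({a, b} : Finset (Sym2 (Site 2))).powerset).card : ℝ) ≤ 4 := by
  have h : (({a, b} : Finset (Sym2 (Site 2))).powerset).card ≤ 4 := by
    rw [Finset.card_powerset]
    calc 2 ^ ({a, b} : Finset (Sym2 (Site 2))).card ≤ 2 ^ 2 :=
          Nat.pow_le_pow_right (by norm_num) Finset.card_le_two
      _ = 4 := by norm_num
  exact_mod_cast h

end FirstHitSucc

/-- STUB 4: unit-scale one-sided ratio bound for the first-hit events of a boundary arc left of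
the window: `P[E(k+1)] ≤ 4 · P[E(k)]` (three-edge surgery at `(k,0)` and flip invariance of
`P_{1/2}`). [folklore] -/
theorem stub_firstHitSuccLe :
    ∀ (α β k₀ k : ℤ), β < k₀ → k₀ ≤ k →
      μ.real (firstHit halfPlane (rowIcc α β) k₀ (k + 1)) ≤ 4 * μ.real (firstHit halfPlane (rowIcc α β) k₀ k) := by
  intro α β k₀ k hβ hk
  classical
  refine (FirstHitSucc.measureReal_le_card_mul
    (({s(bpt k, bpt (k - 1)), s(bpt k, ![k, 1])} : Finset (Sym2 (Site 2))).powerset)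
    (fun D ω => symmDiff ω (↑(insert s(bpt k, bpt (k + 1)) D) : Set (Sym2 (Site 2))))
    (fun D hD => FirstHitSucc.real_preimage_flip hD (measurableSet_firstHit _ _ _ _))
    (fun ω hω h => FirstHitSucc.exists_flip_mem hβ hk ω hω h)).trans ?_
  exact mul_le_mul_of_nonneg_right (FirstHitSucc.card_powerset_pair_le _ _) measureReal_nonneg

end TwoArmLower

end Summit.CriticalPhenomena.CardyFormulaZ2.Cruxes.HalfPlaneMarkDensityLaw.SketchLine
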